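import Summits.QuantumFields.YangMills.Theorems.SwapVirialDeficitBlowUpLeaderChart
import Summits.QuantumFields.YangMills.Theorems.SwapVirialDeficitZeroModeSigmaFourSmallBallSlopes
import HarnessLib

/-!
# The massive-mode rung at fixed `L`, brick J5-L: the LETTER PATHS of the joint blow-up — smoothness in the blow-up parameter and the `t = 0` configuration
# (fcl-p3 g45's memo `memo-24197 — the MASSIVE-MODE RUNG at fixed L` §1 (P) / §2 J5; free-hands support of ⟨stmt-QuantumFields-24197⟩)

Obligation (P) of the abstract shell (✓`BlowUp.smallBall_limit_real_of_blowUp_of_weight`) is one-variable calculus along the blow-up parameter: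
`t ↦ F(config(x; t))` must be `C²` at `0` (✓`BlowUp.tendsto_div_sq_of_contDiffAt`), vanish at `t = 0` on the flat set `Dom₀` and be positive off it.
The configuration is made of LETTERS: the four leaders `leaderTuple a (dil3 t w)` (✓`…BlowUpLeaderChart`, w3 g63's axial tuple) and the followers
`quatToSU2 (p · dilateIm t y)` (✓`…BlowUpFollowerChart`).  This file is the generic, ring-independent half of J5 — the calculus of these letter
paths, read through their unit quaternions (`su2Quat`; the deficit is a polynomial in quaternion coordinates, ✓`trace_quatMatrix_re`):
* §1 ★ `contDiffAt_radialUnit` (`ν = v/‖v‖` is `C^n` off `0` on a real inner product space); the affine raw paths `x̄ + s·x_⊥`, `z₀ + s·Im z` never vanish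
  when `x̄ ≠ 0`, `z₀ ≠ 0`; ★ `contDiff_Xp`, `contDiff_Zp`, ★ `contDiff_Wp` — w3 g63's paths `X, Z, W` of ✓`…SmallBallSlopes` are `C^n` ON ALL OF `ℝ`
  (not only differentiable at `0`, ✓`hasDerivAt_Xp/Zp/Wp`), and the follower path `s ↦ p·Z(s)`;
* §2 ★★ `su2Quat_leaderTuple_dil3` — at a point NON-DEGENERATE AT `t = 0` (`a ≠ 0`, `x̄ ≠ 0`, `ȳ ≠ 0`, `z₀ ≠ 0`) and EVERY `s ∈ ℝ` the leader quaternions are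
  `(X_x(s), W(s), X_y(s), A)`; hence ★★ `contDiff_su2Quat_leaderTuple_dil3` (each leader letter is `C^n` in the blow-up parameter on all of `ℝ`) and
  `su2Quat_quatToSU2_follower` / `contDiff_su2Quat_follower` for the followers (`y₀ ≠ 0`);
* §3 the `t = 0` CONFIGURATION: `dil3 0 w = ((x̄, ȳ), z₀)`; all four leader quaternions are AXIAL and COMMUTE (★ `leaderTuple_dil3_zero_comm`); the slaved
  letter is `C₁(0) = C₀(0)` iff `0 < z₀` (★ `leaderTuple_dil3_zero_one_of_pos`, σ-flat: ★★ `leaderTuple_dil3_zero_mem_sigmaBall_zero`) and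
  `C₁(0) = quatToSU2 (−x̄)` with the FIRST SEAM RELATION OFF BY `2` iff `z₀ < 0` (★ `leaderTuple_dil3_zero_not_mem_sigmaBall_of_neg`); followers sit at
  `quatToSU2 (±p)` by the sign of `y₀` (★ `quatToSU2_follower_zero_of_pos/neg`) — exactly the sign conditions of `Dom₀` in memo §1 (P).
Deliberately NOT here: the ring deficit along the configuration (polynomial in the letters, flat set, `G = g″(0)/2`) — J5 proper, with J3's `Ξ`.
HONEST LABEL: calculus of quaternion letter paths (plumbing for a plan-level fixed-`L` rung of a DRAFT line); NOT ⟨24197⟩; own crux ⟨22884⟩ OPEN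
(blocked-on ⟨19935⟩); the Yang–Mills mass gap is NOT proved; no summit is proved by a line.
Width seat ym-line-sfw-p2-w3 g64 (cell ym-idea-1, free hands), `--supports stmt-QuantumFields-24197`.  THEOREMS ONLY, standard axioms, 0 `sorry`.
References: [cite: Luscher1983, §2]; [cite: Vanbaal2001]; [folklore].
-/

set_option autoImplicit false

noncomputable section

open MeasureTheory Quaternion Set Filter Topology
open scoped Quaternion ENNReal BigOperators ContDiff
open Literature.MathematicalPhysics.QuantumLattice
open Literature.MathematicalPhysics.QuantumFieldTheory (haarProbability)
open Literature.MathematicalPhysics.QuantumFieldTheory.Balaban1983to89.T4HaarSU2Translate (su2Quat_quatToSU2 su2Quat_mul)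
open Literature.Analysis.Calculus (radialUnit radialUnit_def norm_radialUnit)
open Summit.QuantumFields.YangMills.Theorems.SwapTwistDeficit.ToronLog
open Summit.QuantumFields.YangMills.Theorems.SwapVirialDeficit.ZeroModeGroup
open Summit.QuantumFields.YangMills.Theorems.SwapVirialDeficit.ZeroModeSigma

attribute [local instance] Literature.Analysis.FluidPDE.Tao2016.quatMeasurableSpace
  Literature.Analysis.FluidPDE.Tao2016.quatBorelSpace
  Literature.MathematicalPhysics.QuantumLattice.secondCountableTopology_su2

namespace Summit.QuantumFields.YangMills.Theorems.SwapVirialDeficit.BlowUp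

/-! ## §1 Smoothness of the normalisation and of w3's letter paths on all of `ℝ` -/

section Radial

variable {E : Type*} [NormedAddCommGroup E] [InnerProductSpace ℝ E]

/-- ★ **`ν(v) = v/‖v‖` is `C^n` away from `0`** on a real inner product space (the norm is smooth off the origin there; cf. the pointwise derivative
✓`Literature.Analysis.Calculus.hasFDerivAt_radialUnit`). [folklore] -/
theorem contDiffAt_radialUnit {n : ℕ∞} {v : E} (hv : v ≠ 0) : ContDiffAt ℝ n (radialUnit (E := E)) v := by
  have h : (radialUnit (E := E)) = fun y => ‖y‖⁻¹ • y := funext fun y => radialUnit_def y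
  rw [h]
  exact ((contDiffAt_norm ℝ hv).inv (norm_ne_zero_iff.2 hv)).smul contDiffAt_id

end Radial

/-- The raw pair-letter path `x̄ + s·x_⊥` keeps its axial part, so never vanishes when `x̄ ≠ 0`. [folklore] -/
theorem axPart_add_smul_ne_zero {x : ℍ} (hx : axPart x ≠ 0) (s : ℝ) : axPart x + s • trPart x ≠ 0 := by
  intro h0
  apply hx
  have hre : (axPart x + s • trPart x).re = x.re := by simp [axPart, trPart]
  have him : (axPart x + s • trPart x).imI = x.imI := by simp [axPart, trPart]
  rw [h0] at hre him
  ext <;> simp [axPart, ← hre, ← him]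

/-- The raw slaved/follower path `z₀ + s·Im z` keeps its real part, so never vanishes when `z₀ ≠ 0`. [folklore] -/
theorem coe_re_add_smul_im_ne_zero {z : ℍ} (hz : z.re ≠ 0) (s : ℝ) : (z.re : ℍ) + s • z.im ≠ 0 := by
  intro h0
  apply hz
  have hre : ((z.re : ℍ) + s • z.im).re = z.re := by simp
  rw [h0] at hre
  simpa using hre.symm

/-- `D_s x ≠ 0` for EVERY `s` when `x̄ ≠ 0`. [folklore] -/
theorem dilate_ne_zero_of_axPart {x : ℍ} (hx : axPart x ≠ 0) (s : ℝ) : dilate s x ≠ 0 := by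
  rw [dilate_eq_axPart_add]; exact axPart_add_smul_ne_zero hx s

/-- `D³_s z ≠ 0` for EVERY `s` when `z₀ ≠ 0`. [folklore] -/
theorem dilateIm_ne_zero_of_re {z : ℍ} (hz : z.re ≠ 0) (s : ℝ) : dilateIm s z ≠ 0 := by
  rw [dilateIm_eq_re_add]; exact coe_re_add_smul_im_ne_zero hz s

/-- ★ **`X(s) = ν(x̄ + s·x_⊥)` is `C^n` on all of `ℝ`** (`x̄ ≠ 0`). [folklore] -/
theorem contDiff_Xp {n : ℕ∞} {x : ℍ} (hx : axPart x ≠ 0) : ContDiff ℝ n (Xp x) := by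
  have hpath : ContDiff ℝ n (fun s : ℝ => axPart x + s • trPart x) := contDiff_const.add (contDiff_id.smul contDiff_const)
  have h : Xp x = fun s => radialUnit (axPart x + s • trPart x) := rfl
  rw [h, contDiff_iff_contDiffAt]
  intro s
  exact (contDiffAt_radialUnit (axPart_add_smul_ne_zero hx s)).comp s hpath.contDiffAt

/-- ★ **`Z(s) = ν(z₀ + s·Im z)` is `C^n` on all of `ℝ`** (`z₀ ≠ 0`). [folklore] -/
theorem contDiff_Zp {n : ℕ∞} {z : ℍ} (hz : z.re ≠ 0) : ContDiff ℝ n (Zp z) := by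
  have hpath : ContDiff ℝ n (fun s : ℝ => (z.re : ℍ) + s • z.im) := contDiff_const.add (contDiff_id.smul contDiff_const)
  have h : Zp z = fun s => radialUnit ((z.re : ℍ) + s • z.im) := rfl
  rw [h, contDiff_iff_contDiffAt]
  intro s
  exact (contDiffAt_radialUnit (coe_re_add_smul_im_ne_zero hz s)).comp s hpath.contDiffAt

/-- ★ **The slaved letter `W(s) = (Ā·X(s)·A)·Z(s)` is `C^n` on all of `ℝ`** (`x̄ ≠ 0`, `z₀ ≠ 0`; any `A`). [folklore] -/
theorem contDiff_Wp {n : ℕ∞} (A : ℍ) {x z : ℍ} (hx : axPart x ≠ 0) (hz : z.re ≠ 0) : ContDiff ℝ n (Wp A x z) := by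
  have h : Wp A x z = fun s => star A * Xp x s * A * Zp z s := rfl
  rw [h]
  exact ((contDiff_const.mul (contDiff_Xp hx)).mul contDiff_const).mul (contDiff_Zp hz)

/-- The follower path `s ↦ p·Z_y(s)` is `C^n` on all of `ℝ` (`y₀ ≠ 0`; any centre `p`). [folklore] -/
theorem contDiff_mul_Zp {n : ℕ∞} (p : ℍ) {y : ℍ} (hy : y.re ≠ 0) : ContDiff ℝ n (fun s => p * Zp y s) :=
  contDiff_const.mul (contDiff_Zp hy)

/-! ## §2 The leader and follower letters as smooth quaternion paths -/

/-- `dil3 s w` unfolded through the axial/transversal splitting: `((x̄ + s x_⊥, ȳ + s y_⊥), z₀ + s Im z)`. [folklore] -/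
theorem dil3_eq_paths (s : ℝ) (w : (ℍ × ℍ) × ℍ) :
    dil3 s w = ((axPart w.1.1 + s • trPart w.1.1, axPart w.1.2 + s • trPart w.1.2), (w.2.re : ℍ) + s • w.2.im) := by
  rw [dil3_apply, dilate_eq_axPart_add, dilate_eq_axPart_add, dilateIm_eq_re_add]

/-- ★★ **The leader quaternions along the blow-up** at a point non-degenerate at `t = 0` (`a ≠ 0`, `x̄ ≠ 0`, `ȳ ≠ 0`, `z₀ ≠ 0`), for EVERY `s ∈ ℝ`:
`su2Quat ∘ leaderTuple a (dil3 s w) = (X_x(s), W_{A,x,z}(s), X_y(s), A)`, `A = radialUnit (axisPoint a)` (w3 g63's paths of ✓`…SmallBallSlopes`). [folklore] -/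
theorem su2Quat_leaderTuple_dil3 {a : ℍ} (ha : a ≠ 0) {w : (ℍ × ℍ) × ℍ} (hx : axPart w.1.1 ≠ 0) (hy : axPart w.1.2 ≠ 0) (hz : w.2.re ≠ 0) (s : ℝ) :
    su2Quat (leaderTuple a (dil3 s w) 0) = Xp w.1.1 s ∧
      su2Quat (leaderTuple a (dil3 s w) 1) = Wp (radialUnit (axisPoint a)) w.1.1 w.2 s ∧
      su2Quat (leaderTuple a (dil3 s w) 2) = Xp w.1.2 s ∧ su2Quat (leaderTuple a (dil3 s w) 3) = radialUnit (axisPoint a) := by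
  obtain ⟨e0, e1, e2, e3⟩ := leaderTuple_apply a (dil3 s w)
  have hA : ‖radialUnit (axisPoint a)‖ = 1 := norm_axisUnit ha
  have hA0 : radialUnit (axisPoint a) ≠ 0 := by intro h; rw [h, norm_zero] at hA; exact zero_ne_one hA
  have hx' : (dil3 s w).1.1 ≠ 0 := by rw [dil3_apply]; exact dilate_ne_zero_of_axPart hx s
  have hy' : (dil3 s w).1.2 ≠ 0 := by rw [dil3_apply]; exact dilate_ne_zero_of_axPart hy s
  have hz' : (dil3 s w).2 ≠ 0 := by rw [dil3_apply]; exact dilateIm_ne_zero_of_re hz s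
  have hp : ‖slaveP (radialUnit (axisPoint a)) (dil3 s w).1.1‖ = 1 := norm_slaveP hA hx'
  have hp0 : slaveP (radialUnit (axisPoint a)) (dil3 s w).1.1 ≠ 0 := by intro h; rw [h, norm_zero] at hp; exact zero_ne_one hp
  refine ⟨?_, ?_, ?_, ?_⟩
  · rw [e0, su2Quat_quatToSU2_eq_radialUnit hx', dil3_apply, Xp_eq]
  · rw [e1, su2Quat_quatToSU2_eq_radialUnit (mul_ne_zero hp0 hz'), radialUnit_mul_left hp, dil3_apply, Wp_eq]
  · rw [e2, su2Quat_quatToSU2_eq_radialUnit hy', dil3_apply, Xp_eq]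
  · rw [e3, su2Quat_quatToSU2 hA0, hA, inv_one, one_smul]

/-- ★★ **Each leader letter is `C^n` in the blow-up parameter on all of `ℝ`** (through `su2Quat`; non-degenerate at `t = 0`). [folklore] -/
theorem contDiff_su2Quat_leaderTuple_dil3 {n : ℕ∞} {a : ℍ} (ha : a ≠ 0) {w : (ℍ × ℍ) × ℍ} (hx : axPart w.1.1 ≠ 0) (hy : axPart w.1.2 ≠ 0)
    (hz : w.2.re ≠ 0) (μ : Fin 4) : ContDiff ℝ n (fun s : ℝ => su2Quat (leaderTuple a (dil3 s w) μ)) := by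
  fin_cases μ
  · have e : (fun s : ℝ => su2Quat (leaderTuple a (dil3 s w) 0)) = Xp w.1.1 := funext fun s => (su2Quat_leaderTuple_dil3 ha hx hy hz s).1
    simp only [Fin.zero_eta]
    rw [e]; exact contDiff_Xp hx
  · have e : (fun s : ℝ => su2Quat (leaderTuple a (dil3 s w) 1)) = Wp (radialUnit (axisPoint a)) w.1.1 w.2 :=
      funext fun s => (su2Quat_leaderTuple_dil3 ha hx hy hz s).2.1
    simp only [Fin.mk_one]
    rw [e]; exact contDiff_Wp _ hx hz
  · have e : (fun s : ℝ => su2Quat (leaderTuple a (dil3 s w) 2)) = Xp w.1.2 := funext fun s => (su2Quat_leaderTuple_dil3 ha hx hy hz s).2.2.1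
    simp only [Fin.reduceFinMk]
    rw [e]; exact contDiff_Xp hy
  · have e : (fun s : ℝ => su2Quat (leaderTuple a (dil3 s w) 3)) = fun _ => radialUnit (axisPoint a) :=
      funext fun s => (su2Quat_leaderTuple_dil3 ha hx hy hz s).2.2.2
    simp only [Fin.reduceFinMk]
    rw [e]; exact contDiff_const

/-- The follower letter's quaternion along the blow-up: `su2Quat (quatToSU2 (p · D³_s y)) = p · Z_y(s)` for a unit centre `p` and `y₀ ≠ 0`, every `s`. [folklore] -/
theorem su2Quat_quatToSU2_follower {p : ℍ} (hp : ‖p‖ = 1) {y : ℍ} (hy : y.re ≠ 0) (s : ℝ) :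
    su2Quat (quatToSU2 (p * dilateIm s y)) = p * Zp y s := by
  have hp0 : p ≠ 0 := by intro h; rw [h, norm_zero] at hp; exact zero_ne_one hp
  rw [su2Quat_quatToSU2_eq_radialUnit (mul_ne_zero hp0 (dilateIm_ne_zero_of_re hy s)), radialUnit_mul_left hp, Zp_eq]

/-- ★ **Each follower letter is `C^n` in the blow-up parameter on all of `ℝ`** (unit centre `p`, `y₀ ≠ 0`). [folklore] -/
theorem contDiff_su2Quat_follower {n : ℕ∞} {p : ℍ} (hp : ‖p‖ = 1) {y : ℍ} (hy : y.re ≠ 0) :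
    ContDiff ℝ n (fun s : ℝ => su2Quat (quatToSU2 (p * dilateIm s y))) := by
  have e : (fun s : ℝ => su2Quat (quatToSU2 (p * dilateIm s y))) = fun s => p * Zp y s := funext fun s => su2Quat_quatToSU2_follower hp hy s
  rw [e]; exact contDiff_mul_Zp p hy

/-! ## §3 The `t = 0` configuration: axial, commuting leaders; the signs of `z₀` and `y₀` -/

/-- `dil3 0 w = ((x̄, ȳ), z₀)`. [folklore] -/
theorem dil3_zero (w : (ℍ × ℍ) × ℍ) : dil3 0 w = ((axPart w.1.1, axPart w.1.2), (w.2.re : ℍ)) := by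
  rw [dil3_eq_paths]; simp only [zero_smul, add_zero]

/-- `(radialUnit (axisPoint a))` is an axial unit: `‖A‖ = 1`, `A_J = A_K = 0` (`a ≠ 0`). [folklore] -/
theorem axisUnit_unit_axial {a : ℍ} (ha : a ≠ 0) :
    ‖radialUnit (axisPoint a)‖ = 1 ∧ (radialUnit (axisPoint a)).imJ = 0 ∧ (radialUnit (axisPoint a)).imK = 0 := by
  refine ⟨norm_axisUnit ha, ?_, ?_⟩ <;> rw [radialUnit_def] <;> simp [axisPoint]

/-- The leader quaternions AT `t = 0`: `(ν(x̄), ±ν(x̄)·…, ν(ȳ), A)` — precisely `(X_x(0), W(0), X_y(0), A)` with `X(0) = ν(x̄)`,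
`W(0) = Ā ν(x̄) A · ν(z₀) = ν(x̄)·ν(z₀)` (✓`Xp_zero`, ✓`Wp_zero`, ✓`conj_radialUnit_axPart`). [folklore] -/
theorem su2Quat_leaderTuple_dil3_zero {a : ℍ} (ha : a ≠ 0) {w : (ℍ × ℍ) × ℍ} (hx : axPart w.1.1 ≠ 0) (hy : axPart w.1.2 ≠ 0) (hz : w.2.re ≠ 0) :
    su2Quat (leaderTuple a (dil3 0 w) 0) = radialUnit (axPart w.1.1) ∧
      su2Quat (leaderTuple a (dil3 0 w) 1) = radialUnit (axPart w.1.1) * radialUnit (w.2.re : ℍ) ∧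
      su2Quat (leaderTuple a (dil3 0 w) 2) = radialUnit (axPart w.1.2) ∧ su2Quat (leaderTuple a (dil3 0 w) 3) = radialUnit (axisPoint a) := by
  obtain ⟨e0, e1, e2, e3⟩ := su2Quat_leaderTuple_dil3 ha hx hy hz 0
  obtain ⟨hA, hJ, hK⟩ := axisUnit_unit_axial ha
  refine ⟨by rw [e0, Xp_zero], ?_, by rw [e2, Xp_zero], e3⟩
  rw [e1, Wp_zero, conj_radialUnit_axPart hA hJ hK]

/-- Two `SU(2)` elements with commuting quaternions commute. [folklore] -/
theorem su2_comm_of_su2Quat_comm {U V : Matrix.specialUnitaryGroup (Fin 2) ℂ} (h : su2Quat U * su2Quat V = su2Quat V * su2Quat U) :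
    U * V = V * U := by
  rw [← quatToSU2_su2Quat (U * V), ← quatToSU2_su2Quat (V * U), su2Quat_mul, su2Quat_mul, h]

/-- Two `SU(2)` elements with equal quaternions are equal. [folklore] -/
theorem su2_eq_of_su2Quat_eq {U V : Matrix.specialUnitaryGroup (Fin 2) ℂ} (h : su2Quat U = su2Quat V) : U = V := by
  rw [← quatToSU2_su2Quat U, ← quatToSU2_su2Quat V, h]

/-- `ν(z₀)` for real `z₀ ≠ 0` is the axial quaternion `±1`. [folklore] -/
theorem radialUnit_coe_axial {c : ℝ} (hc : c ≠ 0) : (radialUnit (c : ℍ)).imJ = 0 ∧ (radialUnit (c : ℍ)).imK = 0 := by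
  rcases lt_or_gt_of_ne hc with h | h
  · rw [radialUnit_coe_of_neg h]; simp
  · rw [radialUnit_coe_of_pos h]; simp

/-- ★ **At `t = 0` all four leaders COMMUTE pairwise** (their quaternions `ν(x̄)`, `ν(x̄)·ν(z₀)`, `ν(ȳ)`, `A` are axial — one maximal torus).
[cite: Luscher1983, §2] -/
theorem leaderTuple_dil3_zero_comm {a : ℍ} (ha : a ≠ 0) {w : (ℍ × ℍ) × ℍ} (hx : axPart w.1.1 ≠ 0) (hy : axPart w.1.2 ≠ 0) (hz : w.2.re ≠ 0)
    (μ ν : Fin 4) : leaderTuple a (dil3 0 w) μ * leaderTuple a (dil3 0 w) ν = leaderTuple a (dil3 0 w) ν * leaderTuple a (dil3 0 w) μ := by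
  obtain ⟨e0, e1, e2, e3⟩ := su2Quat_leaderTuple_dil3_zero ha hx hy hz
  obtain ⟨-, hJ, hK⟩ := axisUnit_unit_axial ha
  obtain ⟨hxJ, hxK⟩ := radialUnit_axPart_axial w.1.1
  obtain ⟨hyJ, hyK⟩ := radialUnit_axPart_axial w.1.2
  obtain ⟨hcJ, hcK⟩ := radialUnit_coe_axial hz
  -- the slaved letter's quaternion `ν(x̄)·ν(z₀)` is axial too
  have hwJ : (radialUnit (axPart w.1.1) * radialUnit (w.2.re : ℍ)).imJ = 0 := by
    simp [Quaternion.imJ_mul, hxJ, hxK, hcJ, hcK]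
  have hwK : (radialUnit (axPart w.1.1) * radialUnit (w.2.re : ℍ)).imK = 0 := by
    simp [Quaternion.imK_mul, hxJ, hxK, hcJ, hcK]
  -- every letter's quaternion is axial
  have hax : ∀ κ : Fin 4, (su2Quat (leaderTuple a (dil3 0 w) κ)).imJ = 0 ∧ (su2Quat (leaderTuple a (dil3 0 w) κ)).imK = 0 := by
    intro κ
    fin_cases κ
    · exact ⟨by simp only [Fin.zero_eta]; rw [e0]; exact hxJ, by simp only [Fin.zero_eta]; rw [e0]; exact hxK⟩
    · exact ⟨by simp only [Fin.mk_one]; rw [e1]; exact hwJ, by simp only [Fin.mk_one]; rw [e1]; exact hwK⟩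
    · exact ⟨by simp only [Fin.reduceFinMk]; rw [e2]; exact hyJ, by simp only [Fin.reduceFinMk]; rw [e2]; exact hyK⟩
    · exact ⟨by simp only [Fin.reduceFinMk]; rw [e3]; exact hJ, by simp only [Fin.reduceFinMk]; rw [e3]; exact hK⟩
  exact su2_comm_of_su2Quat_comm (axial_comm (hax μ).1 (hax μ).2 (hax ν).1 (hax ν).2)

/-- ★ **`z₀ > 0`: the slaved letter coincides with `C₀` at `t = 0`** (`W(0) = ν(x̄)·1`). [folklore] -/
theorem leaderTuple_dil3_zero_one_of_pos {a : ℍ} (ha : a ≠ 0) {w : (ℍ × ℍ) × ℍ} (hx : axPart w.1.1 ≠ 0) (hy : axPart w.1.2 ≠ 0) (hz : 0 < w.2.re) :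
    leaderTuple a (dil3 0 w) 1 = leaderTuple a (dil3 0 w) 0 := by
  obtain ⟨e0, e1, -, -⟩ := su2Quat_leaderTuple_dil3_zero ha hx hy hz.ne'
  exact su2_eq_of_su2Quat_eq (by rw [e1, e0, radialUnit_coe_of_pos hz, mul_one])

/-- ★ **`z₀ < 0`: the slaved letter is the ANTIPODE `quatToSU2 (−x̄)` of `C₀` at `t = 0`** (`W(0) = −ν(x̄)`). [folklore] -/
theorem leaderTuple_dil3_zero_one_of_neg {a : ℍ} (ha : a ≠ 0) {w : (ℍ × ℍ) × ℍ} (hx : axPart w.1.1 ≠ 0) (hy : axPart w.1.2 ≠ 0) (hz : w.2.re < 0) :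
    leaderTuple a (dil3 0 w) 1 = quatToSU2 (-axPart w.1.1) := by
  obtain ⟨-, e1, -, -⟩ := su2Quat_leaderTuple_dil3_zero ha hx hy hz.ne
  refine su2_eq_of_su2Quat_eq ?_
  rw [e1, radialUnit_coe_of_neg hz, mul_neg, mul_one, su2Quat_quatToSU2_eq_radialUnit (neg_ne_zero.2 hx), radialUnit_def, radialUnit_def,
    norm_neg, smul_neg]

/-- ★★ **`z₀ > 0`: the `t = 0` leaders are σ-FLAT** — all six relations of `ℤ³ ⋊_σ ℤ` hold EXACTLY: `leaderTuple a (dil3 0 w) ∈ sigmaBall 0`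
(✓`Mrel_zero_of_pos`: axial letters commute and `W(0) = ν(x̄)`). [cite: Luscher1983, §2] -/
theorem leaderTuple_dil3_zero_mem_sigmaBall_zero {a : ℍ} (ha : a ≠ 0) {w : (ℍ × ℍ) × ℍ} (hx : axPart w.1.1 ≠ 0) (hy : axPart w.1.2 ≠ 0)
    (hz : 0 < w.2.re) : leaderTuple a (dil3 0 w) ∈ sigmaBall 0 := by
  obtain ⟨e0, e1, e2, e3⟩ := su2Quat_leaderTuple_dil3 ha hx hy hz.ne' 0
  obtain ⟨hA, hJ, hK⟩ := axisUnit_unit_axial ha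
  have hM := Mrel_zero_of_pos hA hJ hK w.1.1 w.1.2 hz
  rw [sigmaBall_eq_preimage_sigmaSet le_rfl, Set.mem_setOf_eq, e0, e1, e2, e3, mem_sigmaSet_iff]
  have h0 := hM 0; have h1 := hM 1; have h2 := hM 2; have h3 := hM 3; have h4 := hM 4; have h5 := hM 5
  simp only [Mrel] at h0 h1 h2 h3 h4 h5
  refine ⟨?_, ?_, ?_, ?_, ?_, ?_⟩
  · rw [h0, norm_zero]
  · rw [h1, norm_zero]
  · rw [h2, norm_zero]
  · rw [h3, norm_zero]
  · rw [h4, norm_zero]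
  · rw [h5, norm_zero]

/-- ★ **`z₀ < 0`: the `t = 0` leaders are NOT σ-flat** — the first seam relation is off by `2`: `leaderTuple a (dil3 0 w) ∉ sigmaBall t` for every
`t < 2` (✓`norm_Mrel_three_zero_of_neg`). [folklore] -/
theorem leaderTuple_dil3_zero_not_mem_sigmaBall_of_neg {a : ℍ} (ha : a ≠ 0) {w : (ℍ × ℍ) × ℍ} (hx : axPart w.1.1 ≠ 0) (hy : axPart w.1.2 ≠ 0)
    (hz : w.2.re < 0) {t : ℝ} (ht : t < 2) : leaderTuple a (dil3 0 w) ∉ sigmaBall t := by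
  intro hmem
  by_cases ht0 : 0 ≤ t
  · obtain ⟨e0, e1, e2, e3⟩ := su2Quat_leaderTuple_dil3 ha hx hy hz.ne 0
    obtain ⟨hA, hJ, hK⟩ := axisUnit_unit_axial ha
    have hM := norm_Mrel_three_zero_of_neg hA hJ hK hx w.1.2 hz
    rw [sigmaBall_eq_preimage_sigmaSet ht0, Set.mem_setOf_eq, e0, e1, e2, e3, mem_sigmaSet_iff] at hmem
    obtain ⟨-, -, -, h3, -, -⟩ := hmem
    simp only [Mrel] at hM
    rw [hM] at h3
    linarith
  · -- a negative tolerance is never met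
    obtain ⟨hcomm, -⟩ := hmem
    have h := hcomm 0 0
    rw [sub_self, norm_zero] at h
    exact ht0 h

/-- `p · D³_0 y = y₀ • p`. [folklore] -/
theorem mul_dilateIm_zero (p y : ℍ) : p * dilateIm 0 y = y.re • p := by
  rw [dilateIm_eq_re_add, zero_smul, add_zero, Quaternion.mul_coe_eq_smul]

/-- Followers at `t = 0`, `y₀ > 0`: the letter sits AT its centre, `quatToSU2 (p · D³_0 y) = quatToSU2 p`. [folklore] -/
theorem quatToSU2_follower_zero_of_pos (p : ℍ) {y : ℍ} (hy : 0 < y.re) : quatToSU2 (p * dilateIm 0 y) = quatToSU2 p := by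
  rw [mul_dilateIm_zero, quatToSU2_smul hy]

/-- Followers at `t = 0`, `y₀ < 0`: the letter sits at the ANTIPODE of its centre, `quatToSU2 (p · D³_0 y) = quatToSU2 (−p)`. [folklore] -/
theorem quatToSU2_follower_zero_of_neg (p : ℍ) {y : ℍ} (hy : y.re < 0) : quatToSU2 (p * dilateIm 0 y) = quatToSU2 (-p) := by
  rw [mul_dilateIm_zero, show y.re • p = (-y.re) • (-p) by rw [smul_neg, neg_smul, neg_neg], quatToSU2_smul (neg_pos.2 hy)]

/-- For a unit centre `p`, the antipode is a DIFFERENT group element: `quatToSU2 (−p) ≠ quatToSU2 p`. [folklore] -/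
theorem quatToSU2_neg_ne {p : ℍ} (hp : ‖p‖ = 1) : quatToSU2 (-p) ≠ quatToSU2 p := by
  have hp0 : p ≠ 0 := by intro h; rw [h, norm_zero] at hp; exact zero_ne_one hp
  intro h
  have h1 := congrArg su2Quat h
  rw [su2Quat_quatToSU2 (neg_ne_zero.2 hp0), su2Quat_quatToSU2 hp0, norm_neg, hp, inv_one, one_smul, one_smul] at h1
  -- `-p = p` forces `p = 0` in characteristic zero
  have h2 : (2 : ℝ) • p = 0 := by rw [two_smul]; nth_rewrite 1 [← h1]; rw [neg_add_cancel]
  exact hp0 ((smul_eq_zero.1 h2).resolve_left (by norm_num))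

end Summit.QuantumFields.YangMills.Theorems.SwapVirialDeficit.BlowUp

end
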